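import Summits.SmoothPoincare4.SmoothPoincare4.Theses.CongruenceShadows
import Summits.SmoothPoincare4.SmoothPoincare4.Theorems.CongruenceShadowsAgkCor6SufficiencyStubSectorCoresHelpers
import Summits.SmoothPoincare4.SmoothPoincare4.Theorems.CongruenceShadowsAgkCor6SufficiencyStubSectorCoresLevelFunction
import Literature.Topology.FourManifolds.TrisectionSectorCollars
import Literature.Topology.FourManifolds.RegularLevelSplitting
import Literature.Topology.FourManifolds.RegularDomainMaps
import Literature.Topology.FourManifolds.ConnectedSum

/-!
# Stub `stub_sectorCores` of line `lp-by-sphere-system-surgery` for crux `AgkCor6Sufficiency`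
(item stmt-SmoothPoincare4-10894, routes CongruenceShadows / GroupTrisection; lead reshape r4, Step A)

**Cored presentation of a Gay–Kirby trisection.**  For a closed connected oriented smooth
`4`-manifold `X` with a balanced Gay–Kirby trisection `S` we exhibit the clause-(ii) data of the
three sectors (`Wᵢ`, `eᵢ : Wᵢ → X`), boundary data `bᵢ`, collars `cᵢ`, a smooth `f : X → ℝ` with
regular level `1/2`, and compact connected orientable `1`-handlebodies `V i` with
`{f ≥ 1/2} ≅ V 0 ⊕ (V 1 ⊕ V 2)`, such that (i) `{f ≤ 1/2} = ⋃ᵢ eᵢ(cᵢ(∂Wᵢ × [0, 1/2]))` and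
(ii) `f (eᵢ (cᵢ (x, t))) = coreProfile t`.

Proof (the lead's recipe, the collar `cᵢ` being chosen *adapted to the Morse function* `φᵢ` of the
handle decomposition of `Wᵢ`, `…StubSectorCoresLevelFunction.lean`): the collar coordinate is
`t = (2/aᵢ)(1 - φᵢ)`, `Fᵢ := coreProfile ∘ t` is smooth on `Wᵢ`, `0` near `∂Wᵢ`, and `f := Fᵢ ∘ eᵢ⁻¹`
on `S i` is well defined (two sectors meet in `eᵢ(∂Wᵢ)`); off the spine `eᵢ` is an equidimensional
immersion at interior points, so `f` is smooth there by Seeley extension, and `f ≡ 0` near the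
spine; `f = 1/2` forces `t = 1/2`, where `coreProfile' ≠ 0` and `d(1 - φᵢ) ≠ 0`: `1/2` is a regular
level.  The cores `V i := {φᵢ ≤ 1 - aᵢ/4} ⊆ Wᵢ` are regular sublevel sets of the adapted Morse
functions, compact connected `1`-handlebodies (`…StubSectorCoresHelpers.lean`);
`{f ≥ 1/2} ≅ V 0 ⊕ (V 1 ⊕ V 2)` is `eᵢ⁻¹` on the three open-closed pieces, and `V i` is oriented by
pulling back the orientation of `{f ≥ 1/2} ⊆ X`.  This file declares the line's statement
`SectorCoresPresentation` (verbatim from the checked skeleton; `coreProfile` is declared, verbatim,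
in `…StubSectorCoresHelpers.lean`) and proves the registered stub `stub_sectorCores`.
References: Gay–Kirby, Geom. Topol. 20 (2016), Def. 1 [GayKirby2016]; Abrams–Gay–Kirby, Geom.
Topol. 22 (2018), proof of Thm. 5 [AbramsGayKirby2018].
-/

noncomputable section

-- the prescribed namespace `Summit.<P>.<Sub>.…` duplicates `SmoothPoincare4` (P = Sub)
set_option linter.dupNamespace false

open Set Function
open scoped Manifold ContDiff Topology

namespace Summit.SmoothPoincare4.SmoothPoincare4.Cruxes.AgkCor6Sufficiency.LpBySphereSystemSurgery

open Literature.Topology.FourManifolds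

/-! ## The statement (verbatim from the skeleton) -/

/-- **Cored presentation of ONE Gay–Kirby trisection** (lead reshape r4, Step A of
`SpineRigidityWithCores`; size L, no new theory): keep the clause-(ii) data of the three sectors
(`S i = eᵢ(Wᵢ)`, `eᵢ` a topological embedding of a compact connected smooth `4`-manifold with
boundary, a `C^∞` immersion off `F`, corner charts on `F`, `S i ∩ S j ⊆ eᵢ(∂Wᵢ)`), choose collars
`cᵢ` of the boundary data `bᵢ` of the `Wᵢ` (`BoundaryData.nonempty_collar_of_compactSpace`) and a
smooth `f : X → ℝ` with regular level `1/2` such that (i) the sublevel set `{f ≤ 1/2}` (the spine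
neighbourhood `N`) is the union of the three closed PRISMS `eᵢ(cᵢ(∂Wᵢ × [0, 1/2]))`, (ii) on the
collars `f` is the fixed profile of the collar coordinate, `f (eᵢ (cᵢ (x, t))) = coreProfile t`,
and (iii) the superlevel set `{f ≥ 1/2}` (the three CORES `eᵢ({tᵢ ≥ 1/2})`, each `≅ Wᵢ` by collar
shrinking) is diffeomorphic to a disjoint union `V 0 ⊕ (V 1 ⊕ V 2)` of compact connected
orientable `1`-handlebodies.  (Recipe: `f := coreProfile ∘ tᵢ ∘ eᵢ⁻¹` on `S i`, `tᵢ` the collar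
coordinate continued by `1`; it vanishes identically near `⋃ ∂Sᵢ`, so it is smooth on `X`.) -/
def SectorCoresPresentation : Prop :=
  ∀ (X : Type) [TopologicalSpace X] [T2Space X] [SecondCountableTopology X]
    [ChartedSpace (EuclideanSpace ℝ (Fin 4)) X] [IsManifold (𝓡 4) ∞ X] [CompactSpace X]
    [ConnectedSpace X] (_ : SmoothOrientation (𝓡 4) X)
    (g k : ℕ) (S : Fin 3 → Set X) (_ : IsBalancedGKTrisection X g k S),
    ∃ (W : Fin 3 → Type) (_ : ∀ i, TopologicalSpace (W i)) (_ : ∀ i, T2Space (W i))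
      (_ : ∀ i, SecondCountableTopology (W i)) (_ : ∀ i, CompactSpace (W i))
      (_ : ∀ i, ConnectedSpace (W i)) (_ : ∀ i, ChartedSpace (EuclideanHalfSpace 4) (W i))
      (_ : ∀ i, IsManifold (𝓡∂ 4) ∞ (W i))
      (e : ∀ i, W i → X) (_ : ∀ i, Topology.IsEmbedding (e i)) (_ : ∀ i, range (e i) = S i)
      (_ : ∀ i w, e i w ∉ (⋂ l, S l) → Manifold.IsImmersionAt (𝓡∂ 4) (𝓡 4) ∞ (e i) w)
      (_ : ∀ i w, e i w ∈ (⋂ l, S l) → IsCornerAt (e i) w)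
      (_ : ∀ i j, j ≠ i → S i ∩ S j ⊆ e i '' (𝓡∂ 4).boundary (W i))
      (b : ∀ i, BoundaryData (𝓡∂ 4) (W i) (𝓡 3)) (c : ∀ i, (b i).Collar)
      (f : X → ℝ) (hf : IsRegularLevel (𝓡 4) f (1 / 2))
      (V : Fin 3 → Type) (_ : ∀ i, TopologicalSpace (V i)) (_ : ∀ i, T2Space (V i))
      (_ : ∀ i, SecondCountableTopology (V i)) (_ : ∀ i, CompactSpace (V i))
      (_ : ∀ i, ConnectedSpace (V i)) (_ : ∀ i, ChartedSpace (EuclideanHalfSpace 4) (V i))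
      (_ : ∀ i, IsManifold (𝓡∂ 4) ∞ (V i))
      (_ : ∀ i, IsHandlebodyOfIndexLE 3 1 (V i)) (_ : ∀ i, IsOrientable (𝓡∂ 4) (V i))
      (_ : RegularSuperlevel hf ≃ₘ⟮𝓡∂ 4, 𝓡∂ 4⟯ (V 0 ⊕ (V 1 ⊕ V 2))),
      f ⁻¹' Set.Iic (1 / 2) =
          ⋃ i, (fun p : (b i).carrier × Set.Icc (0 : ℝ) 1 => e i (c i p)) '' {p | (p.2 : ℝ) ≤ 1 / 2} ∧
      ∀ i (x : (b i).carrier) (t : Set.Icc (0 : ℝ) 1), f (e i (c i (x, t))) = coreProfile t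

/-! ## The registered stub -/

/-- **Stub `stub_sectorCores` — cored presentation of a Gay–Kirby trisection** (Step A of the
AGK Thm. 5 assembly of the line): collars adapted to the Morse functions of the sectors, the
level function `coreProfile ∘ tᵢ ∘ eᵢ⁻¹`, its regular level `1/2`, and the cores
`{φᵢ ≤ 1 - aᵢ/4} ⊆ Wᵢ` (regular sublevel sets of the adapted Morse functions).
[cite: AbramsGayKirby2018, proof of Thm. 5] -/
theorem stub_sectorCores : SectorCoresPresentation := by
  intro X _ _ _ _ _ _ _ o g k S h
  classical
  /- ### clause (ii) data -/
  choose W instTop instCS e hspec using h.2.1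
  letI : ∀ i, TopologicalSpace (W i) := instTop
  letI : ∀ i, ChartedSpace (EuclideanHalfSpace 4) (W i) := instCS
  have hM : ∀ i, IsManifold (𝓡∂ 4) ∞ (W i) := fun i => (hspec i).1
  have hWc : ∀ i, CompactSpace (W i) := fun i => (hspec i).2.1
  have hWconn : ∀ i, ConnectedSpace (W i) := fun i => (hspec i).2.2.1
  have hhd : ∀ i, HasHandleDecomposition 3 (W i) (handleCount 1 k) := fun i => (hspec i).2.2.2.1
  have he : ∀ i, Topology.IsEmbedding (e i) := fun i => (hspec i).2.2.2.2.1
  have hrange : ∀ i, range (e i) = S i := fun i => (hspec i).2.2.2.2.2.1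
  have himm : ∀ i w, e i w ∉ (⋂ l, S l) → Manifold.IsImmersionAt (𝓡∂ 4) (𝓡 4) ∞ (e i) w :=
    fun i => (hspec i).2.2.2.2.2.2.1
  have hcorner : ∀ i w, e i w ∈ (⋂ l, S l) → IsCornerAt (e i) w :=
    fun i => (hspec i).2.2.2.2.2.2.2.1
  have hbd : ∀ i j, j ≠ i → S i ∩ S j ⊆ e i '' (𝓡∂ 4).boundary (W i) :=
    fun i => (hspec i).2.2.2.2.2.2.2.2
  haveI : ∀ i, IsManifold (𝓡∂ 4) ∞ (W i) := hM
  haveI : ∀ i, CompactSpace (W i) := hWc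
  haveI : ∀ i, ConnectedSpace (W i) := hWconn
  have hT2 : ∀ i, T2Space (W i) := fun i => (he i).t2Space
  have hSC : ∀ i, SecondCountableTopology (W i) := fun i => (he i).secondCountableTopology
  haveI : ∀ i, T2Space (W i) := hT2
  haveI : ∀ i, SecondCountableTopology (W i) := hSC
  haveI hWne : ∀ i, Nonempty (W i) := fun i => inferInstance
  have hinv : ∀ i w, Function.invFun (e i) (e i w) = w := fun i =>
    Function.leftInverse_invFun (he i).injective
  have hinv' : ∀ i x, x ∈ S i → e i (Function.invFun (e i) x) = x := fun i x hx =>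
    Function.invFun_eq (show ∃ w, e i w = x by rw [← mem_range, hrange]; exact hx)
  have hinvx : ∀ i (x : X) (w : W i), e i w = x → Function.invFun (e i) x = w :=
    fun i x w hw => hw ▸ hinv i w
  have hpre : ∀ i x, x ∈ S i → ∃ w, e i w = x := fun i x hx => by
    rw [← mem_range, hrange]; exact hx
  /- ### the open sets `U i = X ∖ ⋃_{j ≠ i} S j = eᵢ(Int Wᵢ)` -/
  set U : Fin 3 → Set X := fun i => (⋃ j ∈ {j : Fin 3 | j ≠ i}, S j)ᶜ with hU
  have hUo : ∀ i, IsOpen (U i) := fun i =>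
    (((Set.toFinite _).isClosed_biUnion fun j _ => h.isClosed j)).isOpen_compl
  have hmemU : ∀ i x, x ∈ U i ↔ ∀ j, j ≠ i → x ∉ S j := by
    intro i x
    simp only [hU, mem_compl_iff, mem_iUnion, mem_setOf_eq, exists_prop, not_exists, not_and]
  have hUS : ∀ i, U i ⊆ S i := by
    intro i x hx
    obtain ⟨j, hj⟩ := h.exists_mem x
    by_cases hji : j = i
    · exact hji ▸ hj
    · exact absurd hj ((hmemU i x).1 hx j hji)
  have hUr : ∀ i, U i ⊆ range (e i) := fun i => (hUS i).trans (hrange i).symm.subset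
  have hbdU : ∀ i w, e i w ∈ U i → w ∉ (𝓡∂ 4).boundary (W i) := by
    intro i w hw hwb
    have himg := h.image_boundary_eq (he i) (hrange i) (hbd i)
    have : e i w ∈ S i ∩ (S (i + 1) ∪ S (i + 2)) := himg ▸ mem_image_of_mem _ hwb
    obtain ⟨hn1, hn2, -⟩ := fin3_succ_ne i
    rcases this.2 with h1 | h2
    · exact (hmemU i _).1 hw (i + 1) hn1 h1
    · exact (hmemU i _).1 hw (i + 2) hn2 h2
  have hintU : ∀ i w, e i w ∈ U i → (𝓡∂ 4).IsInteriorPoint w := fun i w hw =>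
    ((𝓡∂ 4).isInteriorPoint_or_isBoundaryPoint w).resolve_right (hbdU i w hw)
  have hUint : ∀ i w, w ∉ (𝓡∂ 4).boundary (W i) → e i w ∈ U i := by
    intro i w hw
    rw [hmemU]
    intro j hji hj
    have hmem : e i w ∈ S i ∩ S j := ⟨hrange i ▸ mem_range_self w, hj⟩
    obtain ⟨w', hw', hww⟩ := hbd i j hji hmem
    rw [(he i).injective hww] at hw'
    exact hw hw'
  have himmU : ∀ i w, e i w ∈ U i → Manifold.IsImmersionAt (𝓡∂ 4) (𝓡 4) ∞ (e i) w := by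
    intro i w hw
    refine himm i w fun hF => ?_
    obtain ⟨hn1, -, -⟩ := fin3_succ_ne i
    exact (hmemU i _).1 hw (i + 1) hn1 (mem_iInter.1 hF (i + 1))
  have hinvs : ∀ i, ContMDiffOn (𝓡 4) (𝓡∂ 4) ∞ (Function.invFun (e i)) (U i) := fun i =>
    contMDiffOn_invFun_of_isImmersionAt (he i) (hUr i) (himmU i)
  have hUdisj : ∀ i j, i ≠ j → Disjoint (U i) (U j) := by
    intro i j hij
    rw [Set.disjoint_left]
    intro x hxi hxj
    exact (hmemU j x).1 hxj i hij (hUS i hxi)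
  /- ### Morse functions, adapted collars, sector level functions -/
  choose φ hφ hcount using hhd
  -- boundary data; the boundary of every sector is nonempty (it contains the central surface)
  set b : ∀ i, BoundaryData (𝓡∂ 4) (W i) (𝓡 3) := fun i => BoundaryManifold.boundaryData 3 (W i)
    with hb
  obtain ⟨x₀, hx₀⟩ := h.nonempty_iInter
  have hne : ∀ i, Nonempty (b i).carrier := by
    intro i
    obtain ⟨hn1, -, -⟩ := fin3_succ_ne i
    have hmem : x₀ ∈ S i ∩ S (i + 1) := ⟨mem_iInter.1 hx₀ i, mem_iInter.1 hx₀ (i + 1)⟩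
    obtain ⟨w, hw, -⟩ := hbd i (i + 1) hn1 hmem
    exact ⟨⟨w, hw⟩⟩
  have hpk := fun i => by
    haveI := hne i
    exact stub_sectorLevelData coreProfile (fun _ => coreProfile_of_le)
      (fun _ => coreProfile_le_half_iff) (fun _ => half_le_coreProfile_iff)
      hasDerivAt_coreProfile_half contDiff_coreProfile (W i) (b i) (φ i) (hφ i)
  choose c F a ha hFs hFc hFbd hFlt hcoreF hregF hregφ hprism using hpk
  have hFne : ∀ i w, F i w ≠ 0 → w ∉ (𝓡∂ 4).boundary (W i) := fun i w hw hb' => hw (hFbd i w hb')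
  have sec : ∀ x : X, ∃ i, x ∈ S i := h.exists_mem
  choose σ hσ using sec
  set f : X → ℝ := fun x => F (σ x) (Function.invFun (e (σ x)) x) with hf
  have hfS : ∀ i x, x ∈ S i → f x = F i (Function.invFun (e i) x) := by
    intro i x hx
    by_cases hji : σ x = i
    · subst hji; rfl
    · -- `x` lies in two sectors, hence in the image of both boundaries, where both vanish
      have h1 : x ∈ e i '' (𝓡∂ 4).boundary (W i) := hbd i (σ x) hji ⟨hx, hσ x⟩
      have h2 : x ∈ e (σ x) '' (𝓡∂ 4).boundary (W (σ x)) :=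
        hbd (σ x) i (Ne.symm hji) ⟨hσ x, hx⟩
      obtain ⟨w₁, hw₁, hw₁e⟩ := h1
      obtain ⟨w₂, hw₂, hw₂e⟩ := h2
      show F (σ x) (Function.invFun (e (σ x)) x) = F i (Function.invFun (e i) x)
      rw [hinvx _ _ _ hw₂e, hinvx _ _ _ hw₁e, hFbd _ _ hw₂, hFbd _ _ hw₁]
  have hfe : ∀ i w, f (e i w) = F i w := fun i w => by
    rw [hfS i (e i w) (hrange i ▸ mem_range_self w), hinv]
  /- ### smoothness of `f` -/
  have hfsmooth : ContMDiff (𝓡 4) 𝓘(ℝ, ℝ) ∞ f := by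
    intro x
    by_cases hxU : ∃ i, x ∈ U i
    · obtain ⟨i, hxi⟩ := hxU
      obtain ⟨w, rfl⟩ := hUr i hxi
      obtain ⟨N, G, hNo, hwN, hG, hGe⟩ :=
        exists_contMDiffOn_extension_of_isImmersionAt (he i) (himmU i w hxi) (hFs i)
      refine (hG.contMDiffAt (hNo.mem_nhds hwN)).congr_of_eventuallyEq ?_
      filter_upwards [hNo.mem_nhds hwN, (hUo i).mem_nhds hxi] with y hyN hyU
      obtain ⟨w', rfl⟩ := hUr i hyU
      rw [hfe, hGe w' hyN]
    · -- near the spine `f` vanishes identically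
      set Z : Set X := ⋃ i, e i '' {w | φ i w ≤ 1 - a i / 8} with hZ
      have hZc : IsClosed Z := by
        refine (isCompact_iUnion fun i => ?_).isClosed
        exact ((isClosed_le (hφ i).1.1.continuous continuous_const).isCompact).image
          (he i).continuous
      have hxZ : x ∉ Z := by
        rintro hxZ'
        obtain ⟨i, w, hw, rfl⟩ : ∃ i w, φ i w ≤ 1 - a i / 8 ∧ e i w = x := by
          simpa [hZ, mem_iUnion] using hxZ'
        refine hxU ⟨i, hUint i w fun hwb => ?_⟩
        have := ((hφ i).2.1 w hwb).1
        have hai := ha i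
        linarith
      refine (contMDiffAt_const (c := (0 : ℝ))).congr_of_eventuallyEq ?_
      filter_upwards [hZc.isOpen_compl.mem_nhds hxZ] with y hy
      obtain ⟨j, hyj⟩ : ∃ j, y ∈ S j := ⟨σ y, hσ y⟩
      obtain ⟨w, rfl⟩ := hpre j y hyj
      rw [hfe]
      refine hFlt j w (not_le.1 fun hle => ?_)
      exact hy (mem_iUnion.2 ⟨j, w, hle, rfl⟩)
  /- ### the regular level `1/2` -/
  have hlevU : ∀ i w, F i w = 1 / 2 → e i w ∈ U i := fun i w hw =>
    hUint i w (hFne i w (by rw [hw]; norm_num))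
  have hreg : ∀ x, f x = 1 / 2 → ¬ IsMCriticalPt (𝓡 4) f x := by
    intro x hx
    obtain ⟨i, hxi⟩ : ∃ i, x ∈ S i := ⟨σ x, hσ x⟩
    obtain ⟨w, rfl⟩ := hpre i x hxi
    rw [hfe] at hx
    exact not_isMCriticalPt_of_comp_eventuallyEq
      ((himmU i w (hlevU i w hx)).contMDiffAt.mdifferentiableAt (by simp))
      (hfsmooth.mdifferentiableAt (by simp)) (Filter.Eventually.of_forall (hfe i)) (hregF i w hx)
  have hflev : IsRegularLevel (𝓡 4) f (1 / 2) := isRegularLevel_of_not_isMCriticalPt hfsmooth hreg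
  /- ### the cores `V i = {φ i ≤ lev i}` -/
  set lev : Fin 3 → ℝ := fun i => 1 - a i / 4 with hlev
  have hlev1 : ∀ i, lev i < 1 := fun i => by simp only [hlev]; linarith [ha i]
  have hint : ∀ i p, φ i p ≤ lev i → (𝓡∂ 4).IsInteriorPoint p := fun i p hp =>
    ((𝓡∂ 4).isInteriorPoint_or_isBoundaryPoint p).resolve_right fun hb' => by
      have := ((hφ i).2.1 p hb').1; linarith [hlev1 i]
  have hregle : ∀ i p, IsMCriticalPt (𝓡∂ 4) (φ i) p → φ i p < lev i := fun i p hp =>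
    not_le.1 fun hle => hregφ i p hle hp
  have hregC : ∀ i p, φ i p = lev i → ¬ IsMCriticalPt (𝓡∂ 4) (φ i) p := fun i p hp hc =>
    (hregle i p hc).ne hp
  set V : Fin 3 → Type := fun i => ↥((φ i) ⁻¹' Iic (lev i)) with hV
  set atlas : ∀ i, HalfSliceAtlas (𝓡∂ 4) ((φ i) ⁻¹' Iic (lev i)) := fun i =>
    sublevelAtlas (hφ i).1.1 (lev i) (hint i) (hregC i) with hatlas
  letI instV : ∀ i, ChartedSpace (EuclideanHalfSpace 4) (V i) := fun i => (atlas i).chartedSpace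
  have hpkg : ∀ i, IsManifold (𝓡∂ 4) ∞ (V i) ∧
      Manifold.IsSmoothEmbedding (𝓡∂ 4) (𝓡∂ 4) ∞ (Subtype.val : V i → W i) ∧
      IsHandlebodyOfIndexLE 3 1 (V i) ∧ CompactSpace (V i) ∧ ConnectedSpace (V i) := fun i =>
    core_package (hφ i) (hcount i) (hlev1 i) (hint i) (hregC i) (hregle i)
  haveI hVM : ∀ i, IsManifold (𝓡∂ 4) ∞ (V i) := fun i => (hpkg i).1
  have hVval : ∀ i, ContMDiff (𝓡∂ 4) (𝓡∂ 4) ∞ (Subtype.val : V i → W i) := fun i =>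
    (hpkg i).2.1.contMDiff
  have hVhb : ∀ i, IsHandlebodyOfIndexLE 3 1 (V i) := fun i => (hpkg i).2.2.1
  have hVc : ∀ i, CompactSpace (V i) := fun i => (hpkg i).2.2.2.1
  have hVconn : ∀ i, ConnectedSpace (V i) := fun i => (hpkg i).2.2.2.2
  have hVT2 : ∀ i, T2Space (V i) := fun i => inferInstanceAs (T2Space ↥((φ i) ⁻¹' Iic (lev i)))
  have hVSC : ∀ i, SecondCountableTopology (V i) := fun i =>
    inferInstanceAs (SecondCountableTopology ↥((φ i) ⁻¹' Iic (lev i)))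
  have hVint : ∀ i (v : V i), e i v.1 ∈ U i := fun i v =>
    hUint i v.1 fun hb' => by
      have := ((hφ i).2.1 v.1 hb').1
      have hv := v.2
      simp only [mem_preimage, mem_Iic] at hv
      linarith [hlev1 i]
  /- ### the superlevel set and its three pieces -/
  set Msup := RegularSuperlevel hflev with hMsup
  have hsupf : ∀ p : Msup, 1 / 2 ≤ f (RegularSublevel.incl _ p) := fun p =>
    (level_le_iff_const_sub_nonpos (RegularSublevel.incl _ p)).2 p.2
  set P : Fin 3 → TopologicalSpace.Opens Msup := fun i =>
    ⟨{p | RegularSublevel.incl _ p ∈ U i}, (hUo i).preimage (RegularSublevel.continuous_incl _)⟩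
    with hP
  have hPcov' : ∀ p : Msup, ∃ i, p ∈ P i := by
    intro p
    obtain ⟨i, hxi⟩ : ∃ i, RegularSublevel.incl _ p ∈ S i := ⟨σ _, hσ _⟩
    obtain ⟨w, hw⟩ := hpre i _ hxi
    refine ⟨i, ?_⟩
    show RegularSublevel.incl _ p ∈ U i
    rw [← hw]
    refine hUint i w (hFne i w ?_)
    have := hsupf p
    rw [← hw, hfe] at this
    intro h0; rw [h0] at this; norm_num at this
  have hPcov : ∀ p : Msup, p ∈ P 0 ∨ p ∈ P 1 ∨ p ∈ P 2 := by
    intro p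
    obtain ⟨i, hi⟩ := hPcov' p
    fin_cases i
    · exact Or.inl hi
    · exact Or.inr (Or.inl hi)
    · exact Or.inr (Or.inr hi)
  have hPdisj : ∀ i j, i ≠ j → Disjoint ((P i : Set Msup)) (P j) := by
    intro i j hij
    rw [Set.disjoint_left]
    intro p hpi hpj
    exact Set.disjoint_left.1 (hUdisj i j hij) hpi hpj
  obtain ⟨Φ₀⟩ : Nonempty (Msup ≃ₘ^∞⟮𝓡∂ 4, 𝓡∂ 4⟯ (P 0 ⊕ (P 1 ⊕ P 2))) :=
    nonempty_diffeomorph_of_partition (P 0) (P 1) (P 2) hPcov (hPdisj 0 1 (by decide))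
      (hPdisj 0 2 (by decide)) (hPdisj 1 2 (by decide))
  /- ### the diffeomorphisms `P i ≅ V i` -/
  have hfwd_mem : ∀ i (p : P i), Function.invFun (e i) (RegularSublevel.incl _ p.1) ∈
      (φ i) ⁻¹' Iic (lev i) := by
    intro i p
    have hx : RegularSublevel.incl _ p.1 ∈ U i := p.2
    obtain ⟨w, hw⟩ := hUr i hx
    rw [← hw, hinv]
    show φ i w ≤ lev i
    rw [← hcoreF, ← hfe, hw]
    exact hsupf p.1
  have hfwd_smooth : ∀ i, ContMDiff (𝓡∂ 4) (𝓡∂ 4) ∞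
      (fun p : P i => Function.invFun (e i) (RegularSublevel.incl _ p.1)) := fun i =>
    (hinvs i).comp_contMDiff ((RegularSublevel.contMDiff_incl _).comp contMDiff_subtype_val)
      fun p => p.2
  have hbwd_mem : ∀ i (v : V i), (fun y => 1 / 2 - f y) (e i v.1) ≤ 0 := by
    intro i v
    rw [← level_le_iff_const_sub_nonpos, hfe, hcoreF]
    exact v.2
  have hbwd_smooth : ∀ i, ContMDiff (𝓡∂ 4) (𝓡 4) ∞ (fun v : V i => e i v.1) := by
    intro i v
    exact ((himmU i v.1 (hVint i v)).contMDiffAt).comp v (hVval i v)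
  have Q : ∀ i, (P i) ≃ₘ^∞⟮𝓡∂ 4, 𝓡∂ 4⟯ (V i) := fun i =>
    { toFun := Set.codRestrict (fun p : P i => Function.invFun (e i) (RegularSublevel.incl _ p.1))
        _ (hfwd_mem i)
      invFun := fun v => ⟨Set.codRestrict (fun v : V i => e i v.1) _ (hbwd_mem i) v, hVint i v⟩
      left_inv := fun p => by
        apply Subtype.ext; apply Subtype.ext
        show e i (Function.invFun (e i) (RegularSublevel.incl _ p.1)) = RegularSublevel.incl _ p.1
        exact hinv' i _ (hUS i p.2)
      right_inv := fun v => by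
        apply Subtype.ext
        show Function.invFun (e i) (e i v.1) = v.1
        exact hinv i v.1
      contMDiff_toFun := (atlas i).contMDiff_codRestrict (hfwd_mem i) (hfwd_smooth i)
      contMDiff_invFun := by
        intro v
        refine (ContMDiffAt.subtypeVal_comp_iff (P i) _ v).1 ?_
        exact ((RegularSublevel.halfSliceAtlas hflev.const_sub).contMDiff_codRestrict (hbwd_mem i)
          (hbwd_smooth i)) v }
  /- ### orientations -/
  have oM : SmoothOrientation (𝓡∂ 4) Msup := RegularSublevel.orientation hflev.const_sub o
  have hVo : ∀ i, IsOrientable (𝓡∂ 4) (V i) := fun i =>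
    ⟨(oM.restrict (P i)).comap (Q i).symm (by simp)⟩
  have Ψ : Msup ≃ₘ⟮𝓡∂ 4, 𝓡∂ 4⟯ (V 0 ⊕ (V 1 ⊕ V 2)) :=
    Φ₀.trans ((Q 0).sumCongr ((Q 1).sumCongr (Q 2)))
  /- ### (i) and (ii) -/
  have hii : ∀ i (x : (b i).carrier) (t : Set.Icc (0 : ℝ) 1), f (e i (c i (x, t))) = coreProfile t :=
    fun i x t => by rw [hfe, hFc]
  have hi : f ⁻¹' Set.Iic (1 / 2) =
      ⋃ i, (fun p : (b i).carrier × Set.Icc (0 : ℝ) 1 => e i (c i p)) '' {p | (p.2 : ℝ) ≤ 1 / 2} := by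
    apply Subset.antisymm
    · intro x hx
      obtain ⟨i, hxi⟩ : ∃ i, x ∈ S i := ⟨σ x, hσ x⟩
      obtain ⟨w, rfl⟩ := hpre i x hxi
      have hFw : F i w ≤ 1 / 2 := by rw [← hfe]; exact hx
      obtain ⟨y, t, ht, hyt⟩ := hprism i w hFw
      exact mem_iUnion.2 ⟨i, (y, t), ht, by simp [hyt]⟩
    · intro x hx
      obtain ⟨i, ⟨y, t⟩, ht, rfl⟩ := mem_iUnion.1 hx
      show f (e i (c i (y, t))) ≤ 1 / 2
      rw [hii]
      exact coreProfile_le_half_iff.2 ht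
  exact ⟨W, instTop, hT2, hSC, hWc, hWconn, instCS, hM, e, he, hrange, himm, hcorner, hbd, b, c, f,
    hflev, V, fun i => inferInstance, hVT2, hVSC, hVc, hVconn, instV, hVM, hVhb, hVo, Ψ, hi, hii⟩

end Summit.SmoothPoincare4.SmoothPoincare4.Cruxes.AgkCor6Sufficiency.LpBySphereSystemSurgery

end
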